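import Literature.MathematicalPhysics.QuantumFieldTheory.Balaban1983to89.B15AveragingHolomorphic
import Literature.MathematicalPhysics.QuantumFieldTheory.Balaban1983to89.B15Prop1AnalyticExtClause
import Literature.MathematicalPhysics.QuantumFieldTheory.Balaban1983to89.BlockAveragingSU2Complex
import Literature.Analysis.Matrix.DetExp

/-!
# `Balaban1983to89.B15SU2ChartHolomorphic` — [Balaban1989LargeFieldI] = «[IV]», Prop. 1 p. 194 (last clause «𝕍_k = V′_kV_k = exp iB′V_k … B′ ∈ 𝔤ᶜ»);
# [Balaban1989LargeFieldII] (1.19) p. 360 («V′ = exp ig_kB»); [Balaban1985Variational] p. 307, Prop. 9 (190) p. 309: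
# THE `SU(2)` EXPONENTIAL CHART OF RECORD IS A MATRIX EXPONENTIAL OF A ℂ-LINEAR MAP — its complexification `z ↦ exp(Σ_a z_a E_a)` on `𝔤ᶜ = ℂ³` is ENTIRE,
# `SL₂(ℂ)`-valued, restricts to `↑(expPoint x)` on real `x`, and intertwines coordinatewise conjugation with the unitary real structure `θ(A) = (A⋆)⁻¹`

Honest framing: statement-level skeleton of published theorems with citation tags; proofs where landed; nothing here is a claim about the
Yang–Mills mass gap.  Cell `pub-ymgap`, HUMAN RULING D-0149 (width seats), seat `pub-ymgap-dag-n12-w1` (N12 = [B15]; U1a ∕ U1A-CENSUS glue (ε)); count-neutral;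
N12 NOT discharged; finite 𝕋⁴ at fixed ε; nothing continuum ∕ OS ∕ mass-gap ∕ Clay.

WHY.  The N12∕s1 letters (J1) ∕ (J0ᵛ) ∕ (J0′) are posed on the COMPLEXIFIED chart parameters `(p, B′) ∈ (ℂ³)^{bonds} × (ℂ³)^{bonds}` (`B15Prop1AnalyticExtClause.cplxVec`)
of the configuration `expMul su2Chart B′ (ext (expMul su2Chart p V_k))`, `su2Chart.iexp = T4HaarSU2ExpChart.expPoint` (the unit quaternion `exp(ι x)` read in `SU(2)`,
`QuantumLattice.quatToSU2 ∘ exp ∘ imQuat`).  The implicit-function route to (J0′) (this seat: `ConstrainedCriticalFamily` over `ℂ`, `B15AveragingHolomorphic`) needs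
the chart itself as a HOLOMORPHIC map of `z ∈ ℂ³`; the tree records «in matrix terms `expPoint x = exp(i x·σ⃗)`» only as an orientation remark (`T4HaarSU2ExpChart`).
THIS MODULE proves it: `quatMatrix` intertwines the exponentials (the tree's `T4QuatExpLog.quatMatrix_exp`, a continuous ring homomorphism commutes with
`NormedSpace.exp`), so `↑(expPoint x) = quatMatrix (exp (ι x)) = exp (quatMatrix (ι x))`, and `quatMatrix (ι x) = Σ_a x_a • E_a` with the three traceless skew-Hermitian matrices `E_a = quatMatrix(i), quatMatrix(j), quatMatrix(k)`;
hence the complexification `expPointC z := exp (Σ_a z_a • E_a)` is ENTIRE in `z` (a matrix exponential of a ℂ-linear map), has determinant `1` (`det exp = exp tr`,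
the tree's `Literature.Analysis.Matrix.det_exp_eq_exp_trace`), and satisfies `(expPointC z)⋆⁻¹ = expPointC (z̄)` (`E_a⋆ = −E_a`) — coordinatewise conjugation on
`𝔤ᶜ = ℂ³` IS the unitary real structure `θ` of `B15AveragingHolomorphic` §5.

CONTENTS.  §1 `genE a` (the three
matrices, DEF), `quatMatrix_imQuat` (`= Σ x_a • E_a`), `genE_trace`, `star_genE`; ★ `expPointC` (DEF), ★★ `coe_expPoint_eq_expPointC` (restriction to real `x`),
★★ `differentiable_expPointC` (entire), ★ `det_expPointC` (`= 1`), ★★ `star_expPointC_inv` (`θ ∘ expPointC = expPointC ∘ conj`).  §2 bond fields: `expMulC` (DEF: `b ↦ expPointC (B b) · W b`,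
the complexified `B16Sect1Backgrounds.expMul su2Chart`), ★ `expMulC_cplxVec_coeField` (`= ↑(expMul su2Chart B W)` on real data), ★ `differentiableAt_expMulC`, `det_expMulC`,
`expMulC_theta`.  §3 the pull-back `Q_k^{s*}` ([BalabanImbrieJaffe1985] (4.5.3); `qsstarGIter0`, generic over any type with a unit) IS its own complexification:
`coeField_qsstarG`, ★ `coeField_qsstarGIter0` (`↑(Q_k^{s*}V) = Q_k^{s*}(↑V)`), `differentiable_qsstarG`, ★ `differentiable_qsstarGIter0`, `qsstarG_map`, ★ `qsstarGIter0_map` (commutes with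
any map fixing `1`, e.g. `θ` or entrywise conjugation), `star_inv_one_eq`.  §4 the holomorphic LOGARITHMIC chart: `trace_genE_mul_genE`, `decomp_genE` (Pauli decomposition of
`M₂(ℂ)`), ★ `logCoordC` (DEF: `(−½ tr(E_a log A))_a`), ★★ `logCoordC_expPointC` (left inverse near `0`), ★ `trace_mlog_eq_zero` (small `SL₂` matrices have
traceless logarithm — `det e^X = e^{tr X}`), ★★ `expPointC_logCoordC` (right inverse on small `SL₂` matrices), ★ `differentiableAt_logCoordC`, ★ `logCoordC_theta`
(`logCoordC ((A⋆)⁻¹) = conj ∘ logCoordC A`: in both charts `θ` is coordinatewise conjugation).  No estimate of print; no `instance`, no `sorry`.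
-/

noncomputable section

namespace Literature.MathematicalPhysics.QuantumFieldTheory.Balaban1983to89.B15SU2ChartHolomorphic

open Literature.MathematicalPhysics.QuantumLattice (quatMatrix coe_quatToSU2_of_norm_eq_one)
open T4QuatExpLog (quatMatrix_exp)
open T4HaarSU2ExpChart (imQuat imQuat_apply expPoint norm_exp_imQuat)
open Literature.MathematicalPhysics.QuantumFieldTheory.Balaban1983to89.Node00 (coeField coeField_apply)
open NormedSpace (exp)
open scoped Matrix.Norms.L2Operator Quaternion


/-! ## §1  The generators `E_a`, the complexified chart `expPointC`, and its four properties -/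

section Chart

/-- The three generators `E_a := quatMatrix` of the imaginary units `i, j, k` (`= quatMatrix (ι e_a)`): traceless, skew-Hermitian; `quatMatrix (ι x) = Σ_a x_a • E_a`.
[cite: Balaban1989LargeFieldII, (1.19) p.360 (bookkeeping)] -/
def genE (a : Fin 3) : Matrix (Fin 2) (Fin 2) ℂ := quatMatrix (imQuat (EuclideanSpace.single a (1 : ℝ)))

/-- `quatMatrix (ι x) = Σ_a x_a • E_a` for real `x ∈ ℝ³`. [cite: Balaban1989LargeFieldII, (1.19) p.360 (bookkeeping)] -/
theorem quatMatrix_imQuat (x : EuclideanSpace ℝ (Fin 3)) : quatMatrix (imQuat x) = ∑ a : Fin 3, ((x a : ℝ) : ℂ) • genE a := by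
  ext i j
  fin_cases i <;> fin_cases j <;> apply Complex.ext <;>
    simp [quatMatrix, genE, imQuat_apply, Fin.sum_univ_three, Matrix.sum_apply]

/-- The generators are traceless. [cite: Balaban1989LargeFieldII, (1.19) p.360 (bookkeeping)] -/
theorem genE_trace (a : Fin 3) : (genE a).trace = 0 := by
  fin_cases a <;> apply Complex.ext <;> simp [genE, quatMatrix, imQuat_apply, Matrix.trace_fin_two]

/-- The generators are skew-Hermitian: `E_a⋆ = −E_a`. [cite: Balaban1989LargeFieldII, (1.19) p.360 (bookkeeping)] -/
theorem star_genE (a : Fin 3) : star (genE a) = -genE a := by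
  fin_cases a <;>
  · ext i j
    fin_cases i <;> fin_cases j <;> apply Complex.ext <;> simp [genE, quatMatrix, imQuat_apply, Matrix.star_apply]

/-- ★ **THE COMPLEXIFIED `SU(2)` CHART** on `𝔤ᶜ = ℂ³`: `expPointC z = exp (Σ_a z_a • E_a)` (a matrix exponential of a ℂ-linear map). [cite: Balaban1989LargeFieldI, Prop. 1 p.194 («B′ ∈ 𝔤ᶜ»); Balaban1985Variational, p.307] -/
def expPointC (z : EuclideanSpace ℂ (Fin 3)) : Matrix (Fin 2) (Fin 2) ℂ := exp (∑ a : Fin 3, z a • genE a)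

/-- ★★ **RESTRICTION TO REAL ARGUMENTS**: on real `x` (embedded coordinatewise, as `B15Prop1AnalyticExtClause.cplxVec` does bondwise) the complexified chart IS the matrix of the
chart of record `expPoint x = quatToSU2 (exp (ι x))`. [cite: Balaban1989LargeFieldI, Prop. 1 p.194; Balaban1989LargeFieldII, (1.19) p.360] -/
theorem coe_expPoint_eq_expPointC (x : EuclideanSpace ℝ (Fin 3)) :
    ((expPoint x : Matrix.specialUnitaryGroup (Fin 2) ℂ) : Matrix (Fin 2) (Fin 2) ℂ) = expPointC (WithLp.toLp 2 fun a => ((x a : ℝ) : ℂ)) := by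
  rw [expPoint, coe_quatToSU2_of_norm_eq_one (norm_exp_imQuat x), quatMatrix_exp, quatMatrix_imQuat, expPointC]

/-- ★★ **THE COMPLEXIFIED CHART IS ENTIRE** (ℂ-differentiable everywhere on `ℂ³`). [cite: Balaban1985Variational, Prop. 9 (190) p.309; Balaban1989LargeFieldI, Prop. 1 p.194] -/
theorem differentiable_expPointC : Differentiable ℂ expPointC := by
  have hlin : Differentiable ℂ (fun z : EuclideanSpace ℂ (Fin 3) => ∑ a : Fin 3, z a • genE a) :=
    Differentiable.fun_sum fun a _ => ((EuclideanSpace.proj a : EuclideanSpace ℂ (Fin 3) →L[ℂ] ℂ).differentiable).smul_const _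
  exact fun z => (NormedSpace.exp_analytic (𝕂 := ℂ) _).differentiableAt.comp z (hlin z)

/-- ★ **THE COMPLEXIFIED CHART IS `SL₂(ℂ)`-VALUED**: `det (expPointC z) = exp (tr Σ z_a E_a) = 1`. [cite: Balaban1985Variational, p.307 («Gᶜ-valued fields»)] -/
theorem det_expPointC (z : EuclideanSpace ℂ (Fin 3)) : (expPointC z).det = 1 := by
  rw [expPointC, Literature.Analysis.Matrix.det_exp_eq_exp_trace]
  have htr : (∑ a : Fin 3, z a • genE a).trace = 0 := by
    rw [Matrix.trace_sum]
    exact Finset.sum_eq_zero fun a _ => by rw [Matrix.trace_smul, genE_trace, smul_zero]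
  rw [htr, NormedSpace.exp_zero]

/-- The complexified chart is invertible everywhere. [cite: Balaban1985Variational, p.307 (bookkeeping)] -/
theorem isUnit_det_expPointC (z : EuclideanSpace ℂ (Fin 3)) : IsUnit (expPointC z).det := by
  rw [det_expPointC]; exact isUnit_one

/-- ★★ **COORDINATEWISE CONJUGATION IS THE UNITARY REAL STRUCTURE THROUGH THE CHART**: `((expPointC z)⋆)⁻¹ = expPointC z̄` (`E_a⋆ = −E_a`, `(e^M)⋆ = e^{M⋆}`, `e^{−M} = (e^M)⁻¹`).
[cite: Balaban1985Variational, p.307, Prop. 9 (190) p.309] -/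
theorem star_expPointC_inv (z : EuclideanSpace ℂ (Fin 3)) :
    (star (expPointC z))⁻¹ = expPointC (WithLp.toLp 2 fun a => starRingEnd ℂ (z a)) := by
  rw [expPointC, expPointC, NormedSpace.star_exp, ← Matrix.exp_neg]
  congr 1
  rw [star_sum, ← Finset.sum_neg_distrib]
  refine Finset.sum_congr rfl fun a _ => ?_
  rw [star_smul, star_genE, smul_neg, neg_neg]
  rfl

end Chart

/-! ## §2  Bond fields: the complexified `expMul su2Chart` -/

section Fields

open T4Continuum B16Sect1Backgrounds
open B15Prop1AnalyticExtClause (cplxVec)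
open B15Prop1ChartSU2 (su2Chart)
open T4CubeChartGnomonic (SU2)

variable {P : Params} {k : ℕ}

/-- ★ **THE COMPLEXIFIED `expMul su2Chart`** on bond-matrix fields: `expMulC B W (b) = expPointC (B b) · W b`. [cite: Balaban1989LargeFieldI, Prop. 1 p.194 («𝕍_k = exp iB′V_k … B′ ∈ 𝔤ᶜ»)] -/
def expMulC (B : VecField P k (EuclideanSpace ℂ (Fin 3))) (W : PBond P k → Matrix (Fin 2) (Fin 2) ℂ) : PBond P k → Matrix (Fin 2) (Fin 2) ℂ :=
  fun b => expPointC (B b) * W b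

/-- ★ **ON REAL DATA THE COMPLEXIFIED `expMul` IS THE MATRIX OF THE `expMul` OF RECORD**: `expMulC (cplxVec p) ↑V = ↑(expMul su2Chart p V)`. [cite: Balaban1989LargeFieldI, Prop. 1 p.194; Balaban1989LargeFieldII, (1.19) p.360] -/
theorem expMulC_cplxVec_coeField (p : VecField P k (EuclideanSpace ℝ (Fin 3))) (V : GaugeField P k SU2) :
    expMulC (cplxVec p) (coeField V) = coeField (expMul su2Chart p V) := by
  funext b
  show expPointC (cplxVec p b) * (V b : Matrix (Fin 2) (Fin 2) ℂ) = ((su2Chart.iexp (p b) * V b : SU2) : Matrix (Fin 2) (Fin 2) ℂ)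
  rw [Submonoid.coe_mul]
  congr 1
  exact (coe_expPoint_eq_expPointC (p b)).symm

/-- ★ **THE COMPLEXIFIED `expMul` IS ℂ-DIFFERENTIABLE** jointly in the chart parameter and the field. [cite: Balaban1985Variational, Prop. 9 (190) p.309] -/
theorem differentiableAt_expMulC {X : Type*} [NormedAddCommGroup X] [NormedSpace ℂ X]
    {B : X → VecField P k (EuclideanSpace ℂ (Fin 3))} {W : X → PBond P k → Matrix (Fin 2) (Fin 2) ℂ} {x : X}
    (hB : DifferentiableAt ℂ B x) (hW : DifferentiableAt ℂ W x) :
    DifferentiableAt ℂ (fun y => expMulC (B y) (W y)) x := by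
  refine differentiableAt_pi.2 fun b => ?_
  have hBb : DifferentiableAt ℂ (fun y => B y b) x := (differentiableAt_pi.1 hB) b
  have hWb : DifferentiableAt ℂ (fun y => W y b) x := (differentiableAt_pi.1 hW) b
  exact ((differentiable_expPointC _).comp x hBb).mul hWb

/-- The complexified `expMul` of an `SL₂`-valued field is `SL₂`-valued. [cite: Balaban1985Variational, p.307 (bookkeeping)] -/
theorem det_expMulC (B : VecField P k (EuclideanSpace ℂ (Fin 3))) (W : PBond P k → Matrix (Fin 2) (Fin 2) ℂ) (b : PBond P k) :
    (expMulC B W b).det = (W b).det := by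
  show (expPointC (B b) * W b).det = (W b).det
  rw [Matrix.det_mul, det_expPointC, one_mul]

/-- ★ **`θ`-SYMMETRY OF THE COMPLEXIFIED `expMul`**: `θ (expMulC B W) = expMulC B̄ (θ W)` bondwise (`θ(A) = (A⋆)⁻¹`), for invertible `W`. [cite: Balaban1985Variational, p.307, Prop. 9 p.309] -/
theorem expMulC_theta (B : VecField P k (EuclideanSpace ℂ (Fin 3))) (W : PBond P k → Matrix (Fin 2) (Fin 2) ℂ) (b : PBond P k) :
    (star (expMulC B W b))⁻¹ = expMulC (fun b' => WithLp.toLp 2 fun a => starRingEnd ℂ (B b' a)) (fun b' => (star (W b'))⁻¹) b := by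
  show (star (expPointC (B b) * W b))⁻¹ = expPointC (WithLp.toLp 2 fun a => starRingEnd ℂ (B b a)) * (star (W b))⁻¹
  rw [star_mul, Matrix.mul_inv_rev, star_expPointC_inv]

end Fields

/-! ## §3  The pull-back `Q_k^{s*}` ([BIJ85] (4.5.3)) is its own complexification: matrix-valued, ℂ-linear, `θ`-symmetric -/

section PullBack

open T4Continuum
open Literature.MathematicalPhysics.QuantumFieldTheory.BalabanImbrieJaffe1984to88.BIJ85Eq453GaugeField (qsstarG qsstarG_apply qsstarGIter0 qsstarGIter0_zero qsstarGIter0_succ)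
open T4CubeChartGnomonic (SU2)

variable {P : Params} {N : ℕ}

/-- The one-step pull-back commutes with the matrix coercion: `↑(Q^{s*}V) = Q^{s*}(↑V)` (the definition is generic over any type with a unit; `↑1 = 1`).
[cite: BalabanImbrieJaffe1985, (4.5.3) p.312] -/
theorem coeField_qsstarG {j : ℕ} (V : GaugeField P (j + 1) (Node00.SU N)) :
    coeField (qsstarG V) = qsstarG (coeField V) := by
  funext b
  simp only [coeField_apply, qsstarG_apply]
  split_ifs <;> simp

/-- The `k`-fold pull-back commutes with the matrix coercion: `↑(Q_k^{s*}V) = Q_k^{s*}(↑V)`. [cite: BalabanImbrieJaffe1985, (4.5.3) p.312] -/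
theorem coeField_qsstarGIter0 : ∀ (k : ℕ) (V : GaugeField P k (Node00.SU N)), coeField (qsstarGIter0 k V) = qsstarGIter0 k (coeField V)
  | 0, V => rfl
  | k + 1, V => by rw [qsstarGIter0_succ, qsstarGIter0_succ, coeField_qsstarGIter0 k, coeField_qsstarG]

/-- The one-step pull-back of matrix fields is ℂ-differentiable (each output bond is the constant `1` or an input bond). [cite: BalabanImbrieJaffe1985, (4.5.3) p.312 (bookkeeping)] -/
theorem differentiable_qsstarG {j : ℕ} :
    Differentiable ℂ (fun V : PBond P (j + 1) → Matrix (Fin N) (Fin N) ℂ =>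
      fun b : PBond P j => qsstarG (G := Matrix (Fin N) (Fin N) ℂ) V b) := by
  refine differentiable_pi.2 fun b => ?_
  by_cases h : blockOf b.tgt = blockOf b.src
  · have : (fun V : PBond P (j + 1) → Matrix (Fin N) (Fin N) ℂ => qsstarG (G := Matrix (Fin N) (Fin N) ℂ) V b) = fun _ => 1 :=
      funext fun V => by rw [qsstarG_apply, if_pos h]
    rw [this]; exact differentiable_const _
  · have : (fun V : PBond P (j + 1) → Matrix (Fin N) (Fin N) ℂ => qsstarG (G := Matrix (Fin N) (Fin N) ℂ) V b) =
        fun V => V ⟨blockOf b.src, b.dir⟩ :=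
      funext fun V => by rw [qsstarG_apply, if_neg h]
    rw [this]
    exact (ContinuousLinearMap.proj (R := ℂ) (φ := fun _ : PBond P (j + 1) => Matrix (Fin N) (Fin N) ℂ) ⟨blockOf b.src, b.dir⟩).differentiable

/-- ★ The `k`-fold pull-back of matrix fields is ℂ-differentiable. [cite: BalabanImbrieJaffe1985, (4.5.3) p.312 (bookkeeping)] -/
theorem differentiable_qsstarGIter0 : ∀ k : ℕ,
    Differentiable ℂ (fun V : PBond P k → Matrix (Fin N) (Fin N) ℂ =>
      fun b : PBond P 0 => qsstarGIter0 (G := Matrix (Fin N) (Fin N) ℂ) k V b)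
  | 0 => differentiable_id
  | k + 1 => by
    have h : (fun V : PBond P (k + 1) → Matrix (Fin N) (Fin N) ℂ => fun b : PBond P 0 => qsstarGIter0 (G := Matrix (Fin N) (Fin N) ℂ) (k + 1) V b) =
        (fun V : PBond P k → Matrix (Fin N) (Fin N) ℂ => fun b : PBond P 0 => qsstarGIter0 (G := Matrix (Fin N) (Fin N) ℂ) k V b) ∘
          (fun V : PBond P (k + 1) → Matrix (Fin N) (Fin N) ℂ => fun b : PBond P k => qsstarG (G := Matrix (Fin N) (Fin N) ℂ) V b) :=
      funext fun V => by simp only [Function.comp_apply, qsstarGIter0_succ]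
    rw [h]
    exact (differentiable_qsstarGIter0 k).comp differentiable_qsstarG

/-- The pull-back commutes with any map fixing `1`, bondwise — in particular with the unitary real structure `θ(A) = (A⋆)⁻¹` and with entrywise conjugation.
[cite: BalabanImbrieJaffe1985, (4.5.3) p.312 (bookkeeping)] -/
theorem qsstarG_map {j : ℕ} {G : Type*} [One G] (f : G → G) (hf : f 1 = 1) (V : PBond P (j + 1) → G) :
    qsstarG (fun c => f (V c)) = fun b => f (qsstarG V b) := by
  funext b
  simp only [qsstarG_apply]
  split_ifs <;> simp [hf]

/-- The `k`-fold pull-back commutes with any map fixing `1`. [cite: BalabanImbrieJaffe1985, (4.5.3) p.312 (bookkeeping)] -/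
theorem qsstarGIter0_map {G : Type*} [One G] (f : G → G) (hf : f 1 = 1) :
    ∀ (k : ℕ) (V : PBond P k → G), qsstarGIter0 k (fun c => f (V c)) = fun b => f (qsstarGIter0 k V b)
  | 0, V => rfl
  | k + 1, V => by rw [qsstarGIter0_succ, qsstarGIter0_succ, qsstarG_map f hf, qsstarGIter0_map f hf k]

/-- `θ(1) = 1`: the pull-back is `θ`-symmetric (`qsstarGIter0_map` with `f = θ`). [cite: Balaban1985Variational, p.307 (bookkeeping)] -/
theorem star_inv_one_eq : (star (1 : Matrix (Fin N) (Fin N) ℂ))⁻¹ = 1 := by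
  rw [star_one, inv_one]

end PullBack

/-! ## §4  The holomorphic LOGARITHMIC chart `logCoordC` (inverse of `expPointC` on `SL₂(ℂ)` near `1`) -/

section LogChart

open MatrixLog (mlog exp_mlog analyticAt_mlog)
open B7BlockAvgLog (mlog_exp)
open ExpMeanLog (norm_mlog_lt_log_two)

/-- `E₀ = diag(i, −i)`. [cite: Balaban1989LargeFieldII, (1.19) p.360 (bookkeeping)] -/
theorem genE_zero_eq : genE 0 = !![Complex.I, 0; 0, -Complex.I] := by
  ext i j
  fin_cases i <;> fin_cases j <;> apply Complex.ext <;> simp [genE, quatMatrix, imQuat_apply]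

/-- `E₁ = [[0, 1], [−1, 0]]`. [cite: Balaban1989LargeFieldII, (1.19) p.360 (bookkeeping)] -/
theorem genE_one_eq : genE 1 = !![0, 1; -1, 0] := by
  ext i j
  fin_cases i <;> fin_cases j <;> apply Complex.ext <;> simp [genE, quatMatrix, imQuat_apply]

/-- `E₂ = [[0, i], [i, 0]]`. [cite: Balaban1989LargeFieldII, (1.19) p.360 (bookkeeping)] -/
theorem genE_two_eq : genE 2 = !![0, Complex.I; Complex.I, 0] := by
  ext i j
  fin_cases i <;> fin_cases j <;> apply Complex.ext <;> simp [genE, quatMatrix, imQuat_apply]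

/-- `tr (E_a E_b) = −2 δ_{ab}`. [cite: Balaban1989LargeFieldII, (1.19) p.360 (bookkeeping)] -/
theorem trace_genE_mul_genE (a b : Fin 3) : (genE a * genE b).trace = if a = b then -2 else 0 := by
  fin_cases a <;> fin_cases b <;> apply Complex.ext <;>
    simp [genE_zero_eq, genE_one_eq, genE_two_eq, Matrix.trace_fin_two] <;> norm_num

/-- **THE PAULI-TYPE DECOMPOSITION OF `M₂(ℂ)`**: `M = ½ tr(M)·1 + Σ_a (−½ tr(E_a M))·E_a` (`{1, E₁, E₂, E₃}` is a basis, `tr(E_aE_b) = −2δ_{ab}`, `tr E_a = 0`).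
[cite: Balaban1989LargeFieldII, (1.19) p.360 (bookkeeping)] -/
theorem decomp_genE (M : Matrix (Fin 2) (Fin 2) ℂ) :
    ((1 / 2 : ℂ) * M.trace) • (1 : Matrix (Fin 2) (Fin 2) ℂ) + ∑ a : Fin 3, (-(1 / 2 : ℂ) * (genE a * M).trace) • genE a = M := by
  ext i j
  simp only [Fin.sum_univ_three, genE_zero_eq, genE_one_eq, genE_two_eq, Matrix.trace_fin_two, Matrix.add_apply, Matrix.smul_apply,
    Matrix.mul_apply, Fin.sum_univ_two, smul_eq_mul]
  fin_cases i <;> fin_cases j <;> apply Complex.ext <;> simp [Complex.mul_re, Complex.mul_im] <;> ring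

/-- ★ **THE HOLOMORPHIC LOGARITHMIC COORDINATES** on `M₂(ℂ)` near `1`: `logCoordC A := (−½ tr(E_a · log A))_a ∈ ℂ³` (`log` = the series (21) `MatrixLog.mlog`). [cite: Balaban1989LargeFieldII, (1.19) p.360 («(1/i) log»); Balaban1985Averaging, (21) p.21] -/
def logCoordC (A : Matrix (Fin 2) (Fin 2) ℂ) : EuclideanSpace ℂ (Fin 3) :=
  WithLp.toLp 2 fun a => -(1 / 2 : ℂ) * (genE a * mlog A).trace

/-- Evaluation of the logarithmic coordinates. [cite: Balaban1985Averaging, (21) p.21 (bookkeeping)] -/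
theorem logCoordC_apply (A : Matrix (Fin 2) (Fin 2) ℂ) (a : Fin 3) : logCoordC A a = -(1 / 2 : ℂ) * (genE a * mlog A).trace := rfl

/-- ★★ **`logCoordC ∘ expPointC = id` NEAR `0`**: for `‖Σ z_a E_a‖ < ln 2`, `logCoordC (expPointC z) = z` (`log ∘ exp = id` there, `B7BlockAvgLog.mlog_exp`, and `tr(E_aE_b) = −2δ_{ab}`).
[cite: Balaban1985Averaging, (21) p.21 («It is an inverse to the exponential function»); Balaban1989LargeFieldII, (1.19) p.360] -/
theorem logCoordC_expPointC (z : EuclideanSpace ℂ (Fin 3)) (hz : ‖∑ a : Fin 3, z a • genE a‖ < Real.log 2) : logCoordC (expPointC z) = z := by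
  ext a
  rw [logCoordC_apply, expPointC, mlog_exp hz, Finset.mul_sum, Matrix.trace_sum]
  simp only [Matrix.mul_smul, Matrix.trace_smul, trace_genE_mul_genE, smul_eq_mul, mul_ite, mul_neg, mul_zero,
    Finset.sum_ite_eq, Finset.mem_univ, if_true]
  ring

/-- ★ **A SMALL `SL₂(ℂ)` MATRIX HAS A TRACELESS LOGARITHM**: `‖A − 1‖ ≤ 1∕3`, `det A = 1` ⇒ `tr (log A) = 0` (`det A = det e^{log A} = e^{tr log A}` — the tree's
`Literature.Analysis.Matrix.det_exp_eq_exp_trace` —, `|tr log A| ≤ 2‖log A‖ < 2 ln 2 < 2π`). [cite: Balaban1985Averaging, (21),(26) pp.21–22; Balaban1985Variational, p.307 («Gᶜ-valued»)] -/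
theorem trace_mlog_eq_zero {A : Matrix (Fin 2) (Fin 2) ℂ} (hA : ‖A - 1‖ ≤ 1 / 3) (hdet : A.det = 1) : (mlog A).trace = 0 := by
  have hA1 : ‖A - 1‖ < 1 := lt_of_le_of_lt hA (by norm_num)
  have hexp : Complex.exp (mlog A).trace = 1 := by
    have h := Literature.Analysis.Matrix.det_exp_eq_exp_trace (mlog A)
    rw [exp_mlog hA1, hdet] at h
    rw [Complex.exp_eq_exp_ℂ]
    exact h.symm
  obtain ⟨n, hn⟩ := Complex.exp_eq_one_iff.1 hexp
  have hnorm : ‖(mlog A).trace‖ < 2 * Real.pi := by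
    have h1 := SU2Mean.norm_trace_le (mlog A)
    have h2 := norm_mlog_lt_log_two hA
    have h3 : Real.log 2 < Real.pi := by
      have := Real.log_two_lt_d9; have := Real.pi_gt_three; linarith
    linarith
  have hn0 : n = 0 := by
    by_contra hne
    have h1 : (1 : ℝ) ≤ |(n : ℝ)| := by
      rw [← Int.cast_abs]; exact_mod_cast Int.one_le_abs hne
    have : 2 * Real.pi ≤ ‖(mlog A).trace‖ := by
      rw [hn, norm_mul, Complex.norm_intCast, norm_mul, norm_mul, Complex.norm_I, mul_one, Complex.norm_real, Complex.norm_ofNat,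
        Real.norm_of_nonneg Real.pi_pos.le]
      nlinarith [Real.pi_pos]
    linarith
  rw [hn, hn0]
  simp

/-- ★★ **`expPointC ∘ logCoordC = id` ON SMALL `SL₂(ℂ)` MATRICES**: `‖A − 1‖ ≤ 1∕3`, `det A = 1` ⇒ `expPointC (logCoordC A) = A` (the Pauli decomposition of the traceless `log A`, then
`exp ∘ log = id`). [cite: Balaban1985Averaging, (21) p.21; Balaban1989LargeFieldII, (1.19) p.360; Balaban1985Variational, p.307] -/
theorem expPointC_logCoordC {A : Matrix (Fin 2) (Fin 2) ℂ} (hA : ‖A - 1‖ ≤ 1 / 3) (hdet : A.det = 1) : expPointC (logCoordC A) = A := by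
  have hA1 : ‖A - 1‖ < 1 := lt_of_le_of_lt hA (by norm_num)
  have hsum : ∑ a : Fin 3, logCoordC A a • genE a = mlog A := by
    have h := decomp_genE (mlog A)
    rw [trace_mlog_eq_zero hA hdet, mul_zero, zero_smul, zero_add] at h
    simpa only [logCoordC_apply] using h
  rw [expPointC, hsum, exp_mlog hA1]

/-- An entry `A ↦ A i j` of `M₂(ℂ)` is ℂ-differentiable (linear on a finite-dimensional space). [cite: Balaban1985Averaging, (21) p.21 (bookkeeping)] -/
private theorem differentiable_entry' (i j : Fin 2) : Differentiable ℂ (fun A : Matrix (Fin 2) (Fin 2) ℂ => A i j) :=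
  (LinearMap.toContinuousLinearMap (Matrix.entryLinearMap ℂ ℂ i j)).differentiable

/-- ★ **THE LOGARITHMIC COORDINATES ARE ℂ-DIFFERENTIABLE** at every `A` with `‖A − 1‖ < 1` (the series logarithm is analytic there, `MatrixLog.analyticAt_mlog`; the trace of a
product with a fixed matrix is linear). [cite: Balaban1985Averaging, (21) p.21 («analytic functions of complex matrices»)] -/
theorem differentiableAt_logCoordC {A : Matrix (Fin 2) (Fin 2) ℂ} (hA : ‖A - 1‖ < 1) : DifferentiableAt ℂ logCoordC A := by
  refine (differentiableAt_piLp 2).2 fun a => ?_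
  simp only [logCoordC_apply]
  have hm : DifferentiableAt ℂ (mlog : Matrix (Fin 2) (Fin 2) ℂ → Matrix (Fin 2) (Fin 2) ℂ) A := (analyticAt_mlog hA).differentiableAt
  have htr : Differentiable ℂ (fun M : Matrix (Fin 2) (Fin 2) ℂ => (genE a * M).trace) := by
    have h : (fun M : Matrix (Fin 2) (Fin 2) ℂ => (genE a * M).trace) =
        fun M => ∑ i : Fin 2, ∑ j : Fin 2, genE a i j * M j i := by
      funext M
      simp only [Matrix.trace, Matrix.diag, Matrix.mul_apply]
    rw [h]
    exact Differentiable.fun_sum fun i _ => Differentiable.fun_sum fun j _ => (differentiable_entry' j i).const_mul _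
  exact ((htr.differentiableAt).comp A hm).const_mul _

/-- ★ **THE LOGARITHMIC COORDINATES INTERTWINE THE UNITARY REAL STRUCTURE WITH CONJUGATION**: `logCoordC ((A⋆)⁻¹) = conj (logCoordC A)` coordinatewise, for `‖A − 1‖ ≤ 1∕3`
(`log((A⋆)⁻¹) = −(log A)⋆` — `B15AveragingHolomorphic.mlog_star_inv` —, `E_a⋆ = −E_a`, `tr(Xᴴ) = conj tr X`, cyclicity).  With `star_expPointC_inv` this says: in BOTH charts the
involution `θ(A) = (A⋆)⁻¹` of `SL₂(ℂ)` (fixed set `SU(2)`) is coordinatewise complex conjugation on `ℂ³`. [cite: Balaban1985Variational, p.307, Prop. 9 (190) p.309; Balaban1985Averaging, (23) p.21] -/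
theorem logCoordC_theta {A : Matrix (Fin 2) (Fin 2) ℂ} (hA : ‖A - 1‖ ≤ 1 / 3) :
    logCoordC ((star A)⁻¹) = WithLp.toLp 2 fun a => starRingEnd ℂ (logCoordC A a) := by
  ext a
  rw [logCoordC_apply, B15AveragingHolomorphic.mlog_star_inv hA]
  show -(1 / 2 : ℂ) * (genE a * -star (mlog A)).trace = starRingEnd ℂ (-(1 / 2 : ℂ) * (genE a * mlog A).trace)
  have hconj : starRingEnd ℂ ((genE a * mlog A).trace) = -(genE a * star (mlog A)).trace := by
    rw [starRingEnd_apply, ← Matrix.trace_conjTranspose, Matrix.conjTranspose_mul, ← Matrix.star_eq_conjTranspose, ← Matrix.star_eq_conjTranspose,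
      star_genE, Matrix.mul_neg, Matrix.trace_neg, Matrix.trace_mul_comm]
  rw [map_mul, hconj, Matrix.mul_neg, Matrix.trace_neg]
  have hc : starRingEnd ℂ (-(1 / 2 : ℂ)) = -(1 / 2 : ℂ) := by
    rw [map_neg, map_div₀, map_one, map_ofNat]
  rw [hc]

end LogChart

end Literature.MathematicalPhysics.QuantumFieldTheory.Balaban1983to89.B15SU2ChartHolomorphic

end
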